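import Literature.MathematicalPhysics.QuantumFieldTheory.Balaban1983to89.Node00.BgRemainderOfRecord
import Literature.MathematicalPhysics.QuantumFieldTheory.Balaban1983to89.B11Eq98V0LettersLatticeUniform
import Literature.MathematicalPhysics.QuantumFieldTheory.Balaban1983to89.MatrixNorms
import Summits.QuantumFields.YangMills.Theorems.BalabanUVNodesN07HessOpOfRecordSymmetric
import Summits.QuantumFields.YangMills.Theorems.UnitScaleTiltProp7HqVOfTraceBound
import HarnessLib

/-!
# (R2) — THE V₀-GROUP LETTER (ℓb) OF [B11] PROPOSITION 4 (98) AT THE RECORD, DISCHARGED modulo the small-field window and the weight profile: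
# `‖curV0 (rhoRec N) (tauRecCLM N) (unitsOfRecord F N U₀) Y‖ ≤ C_V(d, ω, Ω, α, N)·‖Y‖²` on `‖Y‖ < 1∕16`, by the `(c·ρ, c⁻¹·τ)` RESCALING of lit's lattice-uniform V₀ bound;
# and the dualising map of (27) at the record is a CONTRACTION (`Mρ = 1`)

Cell `pub-ymgap` ∕ `ym-nodeO-ideate`, porter lineage `ymgap-nodeO-port-PTB-1` (gen 6) on director-ym №557's (R2)-UNIFORM PORTER hand ([B11] Prop. 4 (98) for
`Node00.WOfRecordAt`, [B9]-class inputs displayed; co-typed with node00-def-Y g37, target `Node00/BgSchemeOfRecordProp4.lean` «(R2) TARGET TYPED 03d1e8860fe95e4c»: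
this file discharges its letter (ℓb) `Prop4LetterV0AtRecord` up to print's domain clause and the level-weight profile, and kills the (ρ)-bound the hand had to display).
`--kind proof --supports stmt-QuantumFields-27238 --as helper`; count-neutral.  [B11] = [Balaban1985Variational]; [B9] = [Balaban1985BackgroundPropagators];
[B7] = [Balaban1985Averaging].

THE LOCATED OBSTRUCTION AND ITS REPAIR.  Lit ✓`B11Eq98V0LettersLatticeUniform.curV0_quadBound_lattice_uniform` (the k-free V₀ bound, (90)–(96)) asks a CONTRACTIVE trace
`‖τ X‖ ≤ ‖X‖`; the record's `τ := tauRecCLM N = tr` on the `L²`-operator-normed fibre `M_N(ℂ)` has `‖tr‖ = N`.  The V₀-group current is homogeneous of degree one in the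
trace letter — ✓`Prop7HqVOfTraceBound.curV0_smul` (cell `ym3-torus`, seat px19, generic carriers; REUSED BY NAME, not re-derived — the same snag was met there for `tr` on
`M₂(ℂ)`) — so `curV0 ρ τ = c • curV0 ρ (c⁻¹·τ)` and lit's theorem applies to the contractive `c⁻¹·τ`; the slot norms are bounded back by the displayed pointwise bound `Mρ` of `ρ`
and `1` (§1 ★`curV0_quadBound_of_traceBound`, generic fibre algebra, constant `c·C_V(Mρ, 1)`).  At the record (§2): `c := N` (`norm_tauRecCLM_le`, [B7] (20) via
✓`MatrixNorms.norm_ntr_le_opNorm`), `Mρ := 1` (★`norm_rhoRec_apply_le`: `ρ(ℓ) = (φ v_ℓ)⋆` by lit ✓`rieszτ_apply`, `‖φ w‖_{op} ≤ ‖w‖_{Frob}` by ✓`MatrixNorms.opNorm_sq_le_sum_norm_sq`,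
Riesz isometry, `‖ℓ ∘ φ‖ ≤ ‖ℓ‖·‖φ‖`), cyclic `*`-trace (✓N07 `tauRec_mul_comm`∕`tauRec_star`), `SU(N)`-unitary bond variables (`unitsOfRecord_mem_U1` via
`CStarRing.norm_of_mem_unitary`; ✓N07 `star_coe_unitsOfRecord`), `1 < L` (`T4Family.hL`) ⇒ ★★`curV0AtRecord_quadBound`:
`‖curV0 (rhoRec N) (tauRecCLM N) (unitsOfRecord F N U₀) Y‖ ≤ (1024(d−1)(ωΩ)³·N·(αω² + 1∕16) + (d−1)(ωΩ)³(136 + 2ωΩ)·N)·‖Y‖²` on `‖Y‖ < 1∕16`, `d = (F.P K).d`.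

WHAT STAYS DISPLAYED (hypotheses of `curV0AtRecord_quadBound`): the plaquette window `‖U₀(∂p) − 1‖ ≤ α·η²` of the background read on lit's bonds (`plaqHolU (unitsOfRecord F N
U₀)`; print's small-field domain (2)∕(14), NOT an estimate) and the weight-profile letters `ω ≥ w̄(levWeight … (bondLevLit F Ω k) 1)`, `Ω ≥ w̲⁻¹(… 1)`, `Ω ≥ w̲⁻¹(levWeight …
(pairLevLit F Ω k) 2)` with `1 ≤ ω, Ω` (k-free by the level profile's provenance — the same letters lit displays).

HONEST FRAMING.  Bookkeeping (a rescaling, norm comparisons) over lit's PROVED V₀ bound and ym3-torus's PROVED τ-homogeneity; nothing of [B11] (90)–(96)∕(98) is re-derived or newly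
estimated here; the other Prop. 4 letters (ℓa-H) (117)∕[B9] Thm 3.13, (ℓa-C) (44), (ℓd) (3.132)-class stay displayed in the hand's door file; (R1)∕(R2) OPEN; K0ᴬ
⟨stmt-QuantumFields-27238⟩ NOT closed; K0ᴬ∕K1ᴬ∕K3ᴬ 0∕3; NODE O 0∕1; COUNT 8∕28 · K 1∕4 UNMOVED; finite `𝕋⁴_{L^K}` at fixed ε — NOT continuum ∕ ℝ⁴ ∕ OS; **the Yang–Mills
mass gap (Clay) is NOT proved by any of this.**  No `sorry`, `instance`, `notation`, `set_option`; standard axioms.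
-/

noncomputable section

open scoped Matrix Matrix.Norms.L2Operator InnerProductSpace ComplexConjugate BigOperators
open NormedSpace Complex

namespace Summit.QuantumFields.YangMills.Theorems.Prop4V0AtRecord

open Literature.MathematicalPhysics.QuantumFieldTheory.Balaban1983to89
open Literature.MathematicalPhysics.QuantumFieldTheory.Balaban1983to89.B9Eq39Adjoint
open Literature.MathematicalPhysics.QuantumFieldTheory.Balaban1983to89.B11Eq26ActionExpansion
open Literature.MathematicalPhysics.QuantumFieldTheory.Balaban1983to89.B11Eq90V0primeBond
open Literature.MathematicalPhysics.QuantumFieldTheory.Balaban1983to89.B11Eq92CommutatorFunctional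
open Literature.MathematicalPhysics.QuantumFieldTheory.Balaban1983to89.B11Eq90V0primeCurrent
open Literature.MathematicalPhysics.QuantumFieldTheory.Balaban1983to89.B11Eq96CommutatorCurrent
open Literature.MathematicalPhysics.QuantumFieldTheory.Balaban1983to89.B11Eq63V0GroupCurrent
open B9SectCLatticeCarrier (Bond)
open B11Eq115Space (NegSup NegSize Space115 levWeight JetSup)

/-! ## §1  Lit's lattice-uniform V₀ bound for a trace of norm `≤ c` and a dualising map of pointwise norm `≤ Mρ` (generic; the trace rescaled by ✓`Prop7HqVOfTraceBound.curV0_smul`) -/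

section V0Bound

open B7Prop1Explicit (U1 mem_U1)
open B9Eq310DeltaPrime (plaqHolU)
open B11Eq111FrakG (nabla115)
open B11Eq98V0LettersLatticeUniform (curV0_quadBound_lattice_uniform)

variable {d : ℕ} {Pd : Fin d → ℕ} {L η : ℝ} [Fact (0 < L)] [Fact (0 < η)]
variable {𝔸 : Type*} [NormedRing 𝔸] [NormedAlgebra ℂ 𝔸] [NormOneClass 𝔸] [CompleteSpace 𝔸] [StarRing 𝔸] [StarModule ℂ 𝔸]

/-- ★ **LIT's LATTICE-UNIFORM V₀ BOUND FOR A TRACE OF NORM `≤ c` AND A DUALISING MAP OF POINTWISE NORM `≤ Mρ`** — ✓`curV0_quadBound_lattice_uniform` applied to the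
rescaled pair `(c·ρ, c⁻¹·τ)` (a CONTRACTIVE trace), transported back by `curV0_smul_smul`, the two slot norms then bounded by `c·Mρ` and `1`:
`‖curV0 ρ τ U Y‖ ≤ C_V(d, ω, Ω, α, c·Mρ)‖Y‖²` on `‖Y‖ < 1∕16` with `C_V = 1024(d−1)(ωΩ)³(cMρ)(αω² + 1∕16) + (d−1)(ωΩ)³(136 + 2ωΩ)(cMρ)`.  Letters as in lit (unitary `U1`-valued
background in the plaquette window `αη²`, weight profile `ω, Ω`). [cite: Balaban1985Variational, (98) p.293, (90)–(96) pp.291–292] -/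
theorem curV0_quadBound_of_traceBound {lev₀ : Bond d Pd → ℕ} {lev₁ : Bond d Pd × Fin d → ℕ}
    (ρ : (𝔸 →L[ℂ] ℂ) →L[ℂ] 𝔸) (τ : 𝔸 →L[ℂ] ℂ) (hτ : ∀ a b : 𝔸, τ (a * b) = τ (b * a)) (hτs : ∀ a : 𝔸, τ (star a) = starRingEnd ℂ (τ a))
    {c : ℝ} (hc : 0 < c) (hτc : ∀ X : 𝔸, ‖τ X‖ ≤ c * ‖X‖) {Mρ : ℝ} (hMρ : 0 ≤ Mρ) (hρ : ∀ ℓ, ‖ρ ℓ‖ ≤ Mρ * ‖ℓ‖)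
    (hL : 1 ≤ L) {U : Bond d Pd → 𝔸ˣ} (hUb : ∀ b, U b ∈ U1 𝔸) (hUst : ∀ b, star (U b : 𝔸) = (((U b)⁻¹ : 𝔸ˣ) : 𝔸))
    {α : ℝ} (hα : 0 ≤ α) (hpl : ∀ p : B9SectCLatticeCarrier.Plaq d Pd, ‖(plaqHolU U p : 𝔸) - 1‖ ≤ α * η ^ 2)
    {ω Ω : ℝ} (hω1 : 1 ≤ ω) (hΩ1 : 1 ≤ Ω) (hω : (NegSup.wSup (levWeight L η lev₀ 1) : ℝ) ≤ ω)
    (hΩ₀ : (NegSup.wInvSup (levWeight L η lev₀ 1) : ℝ) ≤ Ω) (hΩ₁ : (NegSup.wInvSup (levWeight L η lev₁ 2) : ℝ) ≤ Ω)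
    (Y : Space115 L η lev₀ lev₁ (nabla115 η U)) (hY : ‖Y‖ < 1 / 16) :
    ‖curV0 (lev₁ := lev₁) (Dc := nabla115 η U) ρ τ U Y‖ ≤
      (1024 * ((d - 1 : ℕ) : ℝ) * (ω * Ω) ^ 3 * (c * Mρ) * (α * ω ^ 2 + 1 / 16)
        + ((d - 1 : ℕ) : ℝ) * (ω * Ω) ^ 3 * (136 + 2 * (ω * Ω)) * (c * Mρ)) * ‖Y‖ ^ 2 := by
  have hc' : ((c : ℝ) : ℂ) ≠ 0 := Complex.ofReal_ne_zero.2 hc.ne'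
  -- the contractive rescaled trace `τ' := c⁻¹·τ`; `curV0 ρ τ = c • curV0 ρ τ'` (τ-homogeneity, ✓`Prop7HqVOfTraceBound.curV0_smul`)
  set τ' : 𝔸 →L[ℂ] ℂ := ((c : ℝ) : ℂ)⁻¹ • τ with hτ'
  have hτ'_tr : ∀ a b : 𝔸, τ' (a * b) = τ' (b * a) := fun a b => by
    simp only [hτ', FunLike.coe_smul, Pi.smul_apply, hτ a b]
  have hτ'_star : ∀ a : 𝔸, τ' (star a) = starRingEnd ℂ (τ' a) := fun a => by
    simp only [hτ', FunLike.coe_smul, Pi.smul_apply, hτs a, smul_eq_mul, map_mul, map_inv₀, Complex.conj_ofReal]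
  have hτ'_one : ∀ X : 𝔸, ‖τ' X‖ ≤ ‖X‖ := fun X => by
    simp only [hτ', FunLike.coe_smul, Pi.smul_apply, norm_smul, norm_inv, Complex.norm_real, Real.norm_eq_abs, abs_of_pos hc]
    rw [inv_mul_le_iff₀ hc]
    exact hτc X
  have hscale : curV0 (lev₁ := lev₁) (Dc := nabla115 η U) ρ τ U Y = ((c : ℝ) : ℂ) • curV0 (lev₁ := lev₁) (Dc := nabla115 η U) ρ τ' U Y := by
    rw [← Prop7HqVOfTraceBound.curV0_smul, hτ', smul_smul, mul_inv_cancel₀ hc', one_smul]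
  have key := curV0_quadBound_lattice_uniform (L := L) (η := η) (lev₀ := lev₀) (lev₁ := lev₁) ρ τ' hτ'_tr hτ'_star hτ'_one hL hUb
    hUst hα hpl hω1 hΩ1 hω hΩ₀ hΩ₁ Y hY
  -- the two slot norms: `‖ρ‖ ≤ Mρ`, `‖c⁻¹·τ‖ ≤ 1`
  have hρn : ‖ρ‖ ≤ Mρ := ContinuousLinearMap.opNorm_le_bound _ hMρ hρ
  have hτn : ‖τ'‖ ≤ 1 := ContinuousLinearMap.opNorm_le_bound _ zero_le_one fun X => by rw [one_mul]; exact hτ'_one X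
  have hρ0 : 0 ≤ ‖ρ‖ := ContinuousLinearMap.opNorm_nonneg _
  have hτ0 : 0 ≤ ‖τ'‖ := ContinuousLinearMap.opNorm_nonneg _
  have hd0 : 0 ≤ ((d - 1 : ℕ) : ℝ) := Nat.cast_nonneg _
  have hωΩ : 0 ≤ ω * Ω := by positivity
  have hω0 : 0 ≤ ω := by linarith
  have h136 : 0 ≤ 136 + 2 * (ω * Ω) := by positivity
  have step : 1024 * ((d - 1 : ℕ) : ℝ) * (ω * Ω) ^ 3 * ‖ρ‖ * (α * ‖τ'‖ * ω ^ 2 + 1 / 16)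
        + ((d - 1 : ℕ) : ℝ) * (ω * Ω) ^ 3 * (136 + 2 * (ω * Ω)) * ‖ρ‖ * ‖τ'‖
      ≤ 1024 * ((d - 1 : ℕ) : ℝ) * (ω * Ω) ^ 3 * Mρ * (α * 1 * ω ^ 2 + 1 / 16)
        + ((d - 1 : ℕ) : ℝ) * (ω * Ω) ^ 3 * (136 + 2 * (ω * Ω)) * Mρ * 1 := by
    gcongr
  rw [hscale, norm_smul, Complex.norm_real, Real.norm_eq_abs, abs_of_pos hc]
  calc c * ‖curV0 (lev₁ := lev₁) (Dc := nabla115 η U) ρ τ' U Y‖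
      ≤ c * ((1024 * ((d - 1 : ℕ) : ℝ) * (ω * Ω) ^ 3 * Mρ * (α * 1 * ω ^ 2 + 1 / 16)
          + ((d - 1 : ℕ) : ℝ) * (ω * Ω) ^ 3 * (136 + 2 * (ω * Ω)) * Mρ * 1) * ‖Y‖ ^ 2) :=
        mul_le_mul_of_nonneg_left (key.trans (mul_le_mul_of_nonneg_right step (sq_nonneg _))) hc.le
    _ = _ := by ring

end V0Bound

/-! ## §2  AT THE RECORD: (ℓb) for `curV0 (rhoRec N) (tauRecCLM N) (unitsOfRecord F N U₀)` — trace `tr` of norm `N`, unitary `SU(N)` background -/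

section Record

open T4Continuum
open B7Prop1Explicit (U1)
open B9Eq310DeltaPrime (plaqHolU)
open B11Eq111FrakG (nabla115)
open Node00
open Summit.QuantumFields.YangMills.Theorems.N07HessOpOfRecordSymmetric (star_coe_unitsOfRecord tauRec_star tauRec_mul_comm)

variable (F : T4Family) (N : ℕ) [NeZero N] {K : ℕ} (k : ℕ) (Ω : ℕ → Set (Site (F.P K) 0)) (U₀ : GaugeField (F.P K) 0 (SU N))

omit [NeZero N] in
/-- `‖tr X‖ ≤ N·‖X‖` for the record's trace functional on the `L²`-operator-normed `M_N(ℂ)` (✓`MatrixNorms.norm_ntr_le_opNorm`). [cite: Balaban1985Averaging, (20) p.21] -/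
theorem norm_tauRecCLM_le (X : Matrix (Fin N) (Fin N) ℂ) : ‖tauRecCLM N X‖ ≤ N * ‖X‖ := by
  rw [tauRecCLM_apply]
  rcases Nat.eq_zero_or_pos N with hN | hN
  · subst hN
    simp [Matrix.trace]
  have h := MatrixNorms.norm_ntr_le_opNorm X
  have hN' : (0 : ℝ) < N := Nat.cast_pos.2 hN
  rw [MatrixNorms.ntr, Fintype.card_fin, norm_div, Complex.norm_natCast, div_le_iff₀ hN'] at h
  linarith [mul_comm (N : ℝ) ‖X‖]

omit [NeZero N] in
/-- The record's bond units `U₀(b) ∈ SU(N)` lie in lit's class `U1` (`‖u‖ ≤ 1 ∧ ‖u⁻¹‖ ≤ 1`; [B7] (19)). [cite: Balaban1985Averaging, (19) p.21] -/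
theorem unitsOfRecord_mem_U1 [NeZero N] (b : Bond (F.P K).d (fun _ => (F.P K).sitesPerDir 0)) :
    unitsOfRecord F N U₀ b ∈ U1 (Matrix (Fin N) (Fin N) ℂ) := by
  have hu : (unitsOfRecord F N U₀ b : Matrix (Fin N) (Fin N) ℂ) ∈ unitary (Matrix (Fin N) (Fin N) ℂ) := by
    rw [coe_unitsOfRecord]
    exact (Matrix.mem_specialUnitaryGroup_iff.1 (U₀ ((bondToLit (F.P K) 0).symm b)).2).1
  have hu' : (((unitsOfRecord F N U₀ b)⁻¹ : (Matrix (Fin N) (Fin N) ℂ)ˣ) : Matrix (Fin N) (Fin N) ℂ) ∈ unitary (Matrix (Fin N) (Fin N) ℂ) := by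
    rw [← star_coe_unitsOfRecord]
    exact Unitary.star_mem hu
  exact ⟨(CStarRing.norm_of_mem_unitary hu).le, (CStarRing.norm_of_mem_unitary hu').le⟩

omit [NeZero N] in
/-- The fibre identification `φ : ℂ^{N×N} → M_N(ℂ)` is a contraction from the Euclidean (Frobenius) norm to the `L²`-operator norm: `‖φ w‖ ≤ ‖w‖`
(✓`MatrixNorms.opNorm_sq_le_sum_norm_sq`: `‖X‖² ≤ Σ|X_ij|²`). [cite: Balaban1985Averaging, (18)–(20) p.21] -/
theorem norm_phiRec_le_norm (w : WRec N) : ‖phiRec N w‖ ≤ ‖w‖ := by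
  have h1 := MatrixNorms.opNorm_sq_le_sum_norm_sq (phiRec N w)
  have h2 : ∑ i, ∑ j, ‖phiRec N w i j‖ ^ 2 = ‖w‖ ^ 2 := by
    rw [EuclideanSpace.norm_eq, Real.sq_sqrt (Finset.sum_nonneg fun _ _ => sq_nonneg _), Fintype.sum_prod_type]
    rfl
  rw [h2] at h1
  exact (pow_le_pow_iff_left₀ (norm_nonneg _) (norm_nonneg _) two_ne_zero).1 h1

omit [NeZero N] in
/-- ★ **(ρ) DISCHARGED: the dualising map of (27)∕(84) at the record is a contraction, `‖ρ(ℓ)‖ ≤ ‖ℓ‖`** (`Mρ = 1`): `ρ(ℓ) = (φ v_ℓ)⋆` with `v_ℓ` the Riesz vector of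
`ℓ ∘ φ` (lit ✓`rieszτ_apply`), `‖X⋆‖ = ‖X‖`, `‖φ v‖ ≤ ‖v‖ = ‖ℓ ∘ φ‖ ≤ ‖ℓ‖·‖φ‖ ≤ ‖ℓ‖`. [cite: Balaban1985Averaging, (18)–(20) p.21; Balaban1985Variational, (27) p.282] -/
theorem norm_rhoRec_apply_le (ℓ : Matrix (Fin N) (Fin N) ℂ →L[ℂ] ℂ) : ‖rhoRec N ℓ‖ ≤ ‖ℓ‖ := by
  rw [rhoRec, B11Eq98V0primeCurrentSlots.rieszτ_apply, norm_star, ]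
  refine (norm_phiRec_le_norm N _).trans ?_
  rw [LinearIsometryEquiv.norm_map]
  refine (ContinuousLinearMap.opNorm_comp_le _ _).trans ?_
  have hφ : ‖(LinearMap.toContinuousLinearMap (phiRec N).toLinearMap : WRec N →L[ℂ] Matrix (Fin N) (Fin N) ℂ)‖ ≤ 1 :=
    ContinuousLinearMap.opNorm_le_bound _ zero_le_one fun w => by
      rw [one_mul]; exact norm_phiRec_le_norm N w
  have hℓ : 0 ≤ ‖ℓ‖ := norm_nonneg ℓ
  nlinarith

variable [Fact (0 < (F.L : ℝ))] [Fact (0 < (F.P K).eta k)]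

/-- ★★ **(ℓb) AT THE RECORD — THE V₀-GROUP QUADRATIC BOUND for `curV0 (rhoRec N) (tauRecCLM N) (unitsOfRecord F N U₀)` on `‖Y‖ < 1∕16`**, with the constant a CLOSED
TERM in `d, ω, Ω, α, N`: §2 at `c := N` (`‖tr X‖ ≤ N‖X‖`) and `Mρ := 1` (`norm_rhoRec_apply_le`), cyclic `*`-trace (✓N07 `tauRec_mul_comm`, `tauRec_star`), `SU(N)`-unitary bond
variables (`unitsOfRecord_mem_U1`, ✓`star_coe_unitsOfRecord`), `1 < L` (`T4Family.hL`).  DISPLAYED: the plaquette window `‖U₀(∂p) − 1‖ ≤ αη²` of the background (print's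
small-field domain) and the weight-profile letters `ω ≥ w̄`, `Ω ≥ w̲⁻¹` of the level maps (k-free by the profile's provenance, exactly as in lit ✓`curV0_quadBound_lattice_uniform`).
[cite: Balaban1985Variational, (98) p.293, (90)–(96) pp.291–292; Balaban1985BackgroundPropagators, (3.35) p.396] -/
theorem curV0AtRecord_quadBound {α ω Ωw : ℝ} (hα : 0 ≤ α)
    (hpl : ∀ p : B9SectCLatticeCarrier.Plaq (F.P K).d (fun _ => (F.P K).sitesPerDir 0),
      ‖(plaqHolU (unitsOfRecord F N U₀) p : Matrix (Fin N) (Fin N) ℂ) - 1‖ ≤ α * (F.P K).eta k ^ 2)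
    (hω1 : 1 ≤ ω) (hΩ1 : 1 ≤ Ωw) (hω : (NegSup.wSup (levWeight (F.L : ℝ) ((F.P K).eta k) (bondLevLit F Ω k) 1) : ℝ) ≤ ω)
    (hΩ₀ : (NegSup.wInvSup (levWeight (F.L : ℝ) ((F.P K).eta k) (bondLevLit F Ω k) 1) : ℝ) ≤ Ωw)
    (hΩ₁ : (NegSup.wInvSup (levWeight (F.L : ℝ) ((F.P K).eta k) (pairLevLit F Ω k) 2) : ℝ) ≤ Ωw)
    (Y : Space115Lit F N K k Ω U₀) (hY : ‖Y‖ < 1 / 16) :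
    ‖curV0 (lev₁ := pairLevLit F Ω k) (Dc := nabla115 ((F.P K).eta k) (unitsOfRecord F N U₀)) (rhoRec N) (tauRecCLM N) (unitsOfRecord F N U₀) Y‖ ≤
      (1024 * (((F.P K).d - 1 : ℕ) : ℝ) * (ω * Ωw) ^ 3 * N * (α * ω ^ 2 + 1 / 16)
        + (((F.P K).d - 1 : ℕ) : ℝ) * (ω * Ωw) ^ 3 * (136 + 2 * (ω * Ωw)) * N) * ‖Y‖ ^ 2 := by
  have hL : (1 : ℝ) ≤ F.L := by exact_mod_cast F.hL.2.le
  have hN : (0 : ℝ) < N := Nat.cast_pos.2 (NeZero.pos N)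
  have h := curV0_quadBound_of_traceBound (rhoRec N) (tauRecCLM N) (tauRec_mul_comm N) (tauRec_star N) hN (norm_tauRecCLM_le N) zero_le_one
    (fun ℓ => by rw [one_mul]; exact norm_rhoRec_apply_le N ℓ) hL (unitsOfRecord_mem_U1 F N U₀) (star_coe_unitsOfRecord F N U₀) hα hpl hω1 hΩ1 hω hΩ₀
    hΩ₁ Y hY
  simpa only [mul_one] using h

end Record

end Summit.QuantumFields.YangMills.Theorems.Prop4V0AtRecord

end
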